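import Summits.AtomisticToContinuum.BoseEinsteinCondensation.Theses.BECThomsonPrinciple
import Summits.AtomisticToContinuum.BoseEinsteinCondensation.Theorems.GaussianDominationCan.Negative.StructureII
import Summits.AtomisticToContinuum.BoseEinsteinCondensation.Theorems.GaussianDominationCan.Negative.CruxForms
import Literature.MathematicalPhysics.QuantumManyBody.PeriodicBoseGasFourier
import Literature.MathematicalPhysics.QuantumManyBody.PeriodicBoseGasFracEnergy

/-!
# Line `gamma-linearised-root` — registered skeleton (crux-plan v2) for crux `GDTransfer`
(stmt-AtomisticToContinuum-9482, route `BECThomsonPrinciple`: `GDTransfer = GDCan → PeriodicBEC`)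

Planner `planner-cruxplan-stmt-AtomisticToContinuum-9482-gamma-linearised-roo-0`, 2026-08-16.
Idea card `Cruxes/GDTransfer/Ideas/gamma-linearised-root.md` (triage r1-1/2/3: pass; "the LNSS calculus
of the witness lines").  Companion line card: `Lines/gamma-linearised-root.md`.
v2 = v1 rebased on the LANDED configuration-space vocabulary of the sister crux `GaussianDominationCan`
(`Theorems/GaussianDominationCan/Negative/{ProductCalculus,Structure,StructureII,CruxForms}.lean`:
`cellAvg`, `modeProj`, `theta`, `phase`, `sourceIntegral`, `GDIneq`, `InWindow`, `GDCanWith`, with the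
PROVED folklore `cellAvg_comm` (Fubini), `cellAvg_add/sub/const_mul`, `cellAvg_cellAvg`, `cellAvg_update`,
`integral_conj_mul_cellAvg` (self-adjointness), `modeProj_succ`, `theta_update_zero`,
`gaussianDominationCan_iff : GaussianDominationCan ↔ ∀ v …, ∃ ρ₀ C N₀, GDCanWith ρ₀ C N₀ v M`), and pointing at
the PROVED torus mode counting of route `BECGroundStateSOS` (modules
`Theorems.BECGroundStateSOSIRModeCounting` — `ModeCounting.condensate_ge_half`, `sum_inv_norm_latticeShell_le(_sq)`,
`IRModeCounting_proof` — and `Theorems.BECGroundStateSOSPeriodicEnergyFinite` — `periodicEnergyFinite_proof`;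
not imported here only because the check farm had not yet built the former (landed 04:26Z) at planning
time: import them in the stub files).

## The line in one paragraph

Kennedy–Lieb–Shastry at `T = 0`, run variationally on `δ`-near-minimisers (order of limits `δ → 0`
before `t → 0`), with the LNSS excitation operator written in FIRST quantisation: the cell average `P_i`
(`cellAvg`), the flat Fourier coefficient `P_i^{(n)}` (`fourierAvg`: `a_0† a_n = Σ_i P_i^{(n)}`,
`a_n† a_0 = Σ_i e^{ik·x_i} P_i`), the words `Q_S = Π_{i∈S} P_i Π_{i∉S}(1 - P_i)` (`modeProj` — verbatim
the route's inline `let Q`; `wordOn` for a word over a sub-list of particles), the root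
`n̂₀^{-1/2} = Σ_{S≠∅} |S|^{-1/2} Q_S` (`rootInv`), the route's source object `Θ = P₀ n̂₀^{-1/2}`
(`theta`; `example : theta m L Φ.ψ = <the route's let-expression> := rfl` below), the annihilator
`Λ_n = n̂₀^{-1/2} a_0† a_n` (`lnssLower`), and the card's lever, the Γ-LINEARISATION
`Θ = π^{-1/2} ∫₀^∞ t^{-1/2} e^{-t} P₀ Π_{i≠0}(1 - (1 - e^{-t})P_i) dt` (`gammaWord`,
`stub_gammaLinearisation`): every identity of the LNSS algebra becomes the expansion of a finite product of
COMMUTING one-body operators under one `t`-integral (no `2^{N-1}` subset sums, no Fock space).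

Skeleton (6 registered stubs; the composition `GDTransfer_of` is pure logic plus one case split on
`∫ v < ∞`):

* `stub_gammaLinearisation : GammaLinearisation` — the Γ/Laplace representation of `Θ` [size M].
* `stub_numberIdentity : GammaLinearisation → NumberIdentity` — `‖Λ_n Φ‖² = ⟨φ_n, γ_Φ φ_n⟩`
  (`Λ_n†Λ_n = n_n` in configuration space; the crux text's "Λ†Λ = n_k unbuilt") [size M/L].
* `stub_coreViolation : CoreViolationFormula` — the exact discrete-derivative formula for a weighted
  subset sum `Σ_S w_{|S|} Q_S g` on a foreign core of a function `g` vanishing there [size M].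
* `stub_bareKLS : NumberIdentity → GaussianDominationCan → ∀ v admissible, ∫v < ∞ → WindowDepletionBound v`
  — SOFT HALF: bare witness `ζ_θ = (e^{iθ}Λ_n + e^{-iθ}Λ_n†)Ψ`, interaction double commutator made
  two-body local by the product form, near-minimiser plumbing (`ChordLimitKLS` of line
  `slack-first-phase-averaged-kls`), d = 3 window sums [size L].
* `stub_dressedKLS : GammaLinearisation → NumberIdentity → CoreViolationFormula → GaussianDominationCan →
  ∀ v admissible, ∫v = ∞ → WindowDepletionBound v` — HARD HALF (hard cores and non-integrable finite
  `v`): the symmetrised Γ-product DRESSED witness (each factor `1 - cP_i` replaced by `1 - cF_iP_iF_i`,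
  `F_i` the scattering-profile dressing of particle `i`), m-side defect in window aggregate, energy side
  by local commutators [size XL — the HARDEST stub, contains the open core of the crux].
* `stub_modeCounting : ∀ v admissible, WindowDepletionBound v → PeriodicBECFor v` — Parseval on the cell,
  kinetic Chebyshev tail, Dyson's upper bound: the proof of `Theorems.ModeCounting.condensate_ge_half` /
  `IRModeCounting_proof` with the infrared-window step replaced by the aggregate hypothesis
  [size M, provable now].

`GDTransfer_of` concludes `Summit.AtomisticToContinuum.BoseEinsteinCondensation.Theses.BECThomsonPrinciple.GDTransfer`
BY NAME; `gdTransfer_iff` certifies (by `Iff.rfl`) that the crux is literally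
`GaussianDominationCan → ∀ v, IsRepulsiveFiniteRange v → PeriodicBECFor v`.

Why the interface is the AGGREGATE `WindowDepletionBound` and not the per-mode `√ρ/|k|` law of
`BECGroundStateSOS.PeriodicIRBound` (which would let `IRModeCounting_proof` be used verbatim): the safe
(self-consistent) KLS bound of the interaction second variation, `≤ c₂ρ‖v‖₁(x + 1)` (ideator 1 /
triage 2; dressed: `c₂ρa(x̃+1)`), yields `n_k ≤ 4π√C + 16π²Cc₂ρ/k² + …`, whose `ρ/k²` term is NOT of
the shape `C√ρL/‖n‖` uniformly at the bottom of the window, but whose window SUM is `O(M√ρ N)`; the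
aggregate interface accepts both the sharp and the self-consistent law.

Disproof honoured (standing disprover's `Disproof.lean`, gen-2 v3b — file not mounted on this hub, cited
from its evidence notes): `not_gdTransfer_iff` (¬GDTransfer ↔ GDCan ∧ ¬PeriodicBEC: both KLS stubs
CONSUME `GaussianDominationCan` at the given `v`, nothing here is GD-free); free-constant tightness
`C ≥ 1/4π²` (landed as `Negative.free_const_ge` / `not_gaussianDominationCan_sharp`; no stub assumes a
small GD constant — the window sums absorb any `C(v,M)`); `periodicBECAtLinearWindow_false` (all slacks
are `∃ δ > 0` chosen after `N`, never `δ = εN`); `gdChord_of_energy_top` (GD is silent at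
infinite-energy states — the reason for the split at `∫v = ∞`); §5 truncation dichotomy (no stub composes
the consequent along truncations `v ∧ n`: the dressed witness is built for the GIVEN `v`); landed
`Negative.gaussianDominationCan_false_without_n_ne_zero` / `_false_without_symm` concern hypotheses INSIDE
GDCan (used here only as a hypothesis, verbatim).  No `GDTransfer_false_without_<H>` is named in any note.

Conventions validated numerically this session (discrete ring model, N = 2, 3, two modes; pure python,
planner folder NOTES.md): `‖Λ_kΨ‖² = n_k` to 1e-16, `N⟨Ψ, e^{ik·x₀}Θ_Ψ⟩ = ⟨Λ_kΨ, Ψ⟩` (so the route's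
source functional `2(m+1)‖sourceIntegral‖` is `2|⟨Ψ, Λ_k†Ψ⟩|` with `Λ_k = lnssLower`), Γ-linearisation
of `Θ` to 1e-16, `‖Λ_k†Ψ‖² = ⟨(n_k+1)1(n̂₀ ≥ 1)⟩`.
-/

noncomputable section

namespace Summit.AtomisticToContinuum.BoseEinsteinCondensation.Cruxes.GDTransfer.GammaLinearisedRoot

open MeasureTheory Filter
open scoped ENNReal ComplexConjugate BigOperators
open Literature.MathematicalPhysics.QuantumManyBody.BoseGas
open Summit.AtomisticToContinuum.BoseEinsteinCondensation.Theses.BECThomsonPrinciple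
open Summit.AtomisticToContinuum.BoseEinsteinCondensation.Theorems.GaussianDominationCan.Negative
  (cellAvg modeProj theta phase sourceIntegral GDIneq InWindow GDCanWith)

variable {m : ℕ}

/-! ## First-quantised LNSS vocabulary (over `Negative.cellAvg/modeProj/theta`; `N = m + 1`) -/

/-- The route's inline source object IS `theta` (definitional unfolding only; cf.
`Negative.gaussianDominationCan_iff`). -/
example (L : ℝ) (Φ : PeriodicTrialState (m + 1) L) :
    theta m L Φ.ψ =
      (let P : Fin (m + 1) → (Config (m + 1) → ℂ) → (Config (m + 1) → ℂ) := fun i g X =>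
          ((L ^ 3)⁻¹ : ℝ) • ∫ y in cell L, g (Function.update X i y)
       let Q : Finset (Fin (m + 1)) → (Config (m + 1) → ℂ) → (Config (m + 1) → ℂ) := fun S g =>
          (List.finRange (m + 1)).foldr (fun i h => if i ∈ S then P i h else h - P i h) g
       fun X => ∑ S ∈ (Finset.univ : Finset (Finset (Fin (m + 1)))).filter
          (fun S => (0 : Fin (m + 1)) ∈ S), ((Real.sqrt (S.card : ℝ))⁻¹ : ℂ) * Q S Φ.ψ X) :=
  rfl

/-- The **flat Fourier coefficient** `P_i^{(n)} g (X) = L⁻³ ∫_{cell} conj(e_n(y)) g(X; x_i ↦ y) dy`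
(`e_n = cellWave L n`): the one-body operator `|φ₀⟩⟨φ_n|` acting on particle `i`, so that
`a_0† a_n = Σ_i P_i^{(n)}`; its output does not depend on `x_i`; `P_i^{(0)} = P_i`. -/
def fourierAvg (L : ℝ) (n : Fin 3 → ℤ) (i : Fin (m + 1)) (g : Config (m + 1) → ℂ) :
    Config (m + 1) → ℂ :=
  fun X => ((L ^ 3)⁻¹ : ℝ) • ∫ y in cell L, conj (cellWave L n y) * g (Function.update X i y)

/-- The word `Π_{i ∈ T ∩ S} P_i · Π_{i ∈ T \ S} (1 - P_i)` over an explicit particle list `T`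
(foldr: the LAST index of `T` acts first; all factors commute on continuous functions, `cellAvg_comm`).
`modeProj (m+1) L S = wordOn L (List.finRange (m+1)) S` definitionally (`modeProj_eq_wordOn`). -/
def wordOn (L : ℝ) (T : List (Fin (m + 1))) (S : Finset (Fin (m + 1))) (g : Config (m + 1) → ℂ) :
    Config (m + 1) → ℂ :=
  T.foldr (fun i h => if i ∈ S then cellAvg (m + 1) L i h else h - cellAvg (m + 1) L i h) g

theorem modeProj_eq_wordOn (L : ℝ) (S : Finset (Fin (m + 1))) (g : Config (m + 1) → ℂ) :
    modeProj (m + 1) L S g = wordOn L (List.finRange (m + 1)) S g :=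
  rfl

/-- `n̂₀^{-1/2} g := Σ_{S ≠ ∅} |S|^{-1/2} Q_S g` (zero on `ker n̂₀ = ran Q_∅`). -/
def rootInv (L : ℝ) (g : Config (m + 1) → ℂ) : Config (m + 1) → ℂ :=
  fun X => ∑ S ∈ (Finset.univ : Finset (Finset (Fin (m + 1)))).filter (fun S => S.Nonempty),
    ((Real.sqrt (S.card : ℝ))⁻¹ : ℂ) * modeProj (m + 1) L S g X

/-- The LNSS **excitation annihilation operator** in configuration space,
`Λ_n g := n̂₀^{-1/2} a_0† a_n g = n̂₀^{-1/2} (Σ_i P_i^{(n)} g)` — the adjoint of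
`Λ_n† = a_n† a_0 n̂₀^{-1/2} = Σ_i e^{ik·x_i} P_i n̂₀^{-1/2}`, whose expectation
`⟨Φ, Λ_n†Φ⟩ = (m+1) · sourceIntegral m L n Φ.ψ` is the source measured by `GaussianDominationCan`. -/
def lnssLower (L : ℝ) (n : Fin 3 → ℤ) (g : Config (m + 1) → ℂ) : Config (m + 1) → ℂ :=
  rootInv L (fun X => ∑ i : Fin (m + 1), fourierAvg L n i g X)

/-- The **Γ-product word** `R_t g := P₀ Π_{i ≠ 0} (1 - (1 - e^{-t}) P_i) g`
(`= e^{t} · P₀ e^{-t n̂₀} g`, since `e^{-tP} = 1 - (1 - e^{-t})P` for a projection `P`). -/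
def gammaWord (L : ℝ) (t : ℝ) (g : Config (m + 1) → ℂ) : Config (m + 1) → ℂ :=
  (List.finRange (m + 1)).foldr
    (fun i h => if i = 0 then cellAvg (m + 1) L i h
      else h - ((1 - Real.exp (-t) : ℝ) : ℂ) • cellAvg (m + 1) L i h) g

/-! ## The typed intermediate statements of the line -/

/-- **Γ-linearisation of the root** (the card's lever, its `First lemma`):
`Θ_Φ(X) = π^{-1/2} ∫₀^∞ t^{-1/2} e^{-t} (R_t Φ)(X) dt` — expand `Π_{i≠0}((1 - P_i) + e^{-t} P_i)` into
`Σ_{T ⊆ {1..m}} e^{-t|T|} Q_{T ∪ {0}}`, Fubini over the finite sum,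
`∫₀^∞ t^{-1/2} e^{-t(1+|T|)} dt = √π (1+|T|)^{-1/2}` (`Real.Gamma_one_half_eq`); the Bochner integrand is
bounded by `2^m sup|Φ| t^{-1/2} e^{-t}`. -/
def GammaLinearisation : Prop :=
  ∀ (m : ℕ) (L : ℝ), 0 < L → ∀ (Φ : PeriodicTrialState (m + 1) L) (X : Config (m + 1)),
    theta m L Φ.ψ X = ((Real.sqrt Real.pi)⁻¹ : ℂ) *
      ∫ t in Set.Ioi (0 : ℝ), ((t ^ (-(1 / 2 : ℝ)) * Real.exp (-t) : ℝ) : ℂ) * gammaWord L t Φ.ψ X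

/-- **Number identity** `Λ_n† Λ_n = n_n` in first quantisation: for a periodic trial state,
`∫_{cell^N} |Λ_n Φ|² = ⟨φ_n, γ_Φ φ_n⟩ = cellOccupation N L (planeWaveMode L n) Φ.ψ`
(second-quantised content: `a_0 n̂₀⁻¹ a_0† = 1`; in the Γ-calculus a factor-by-factor computation plus a
Beta integral; or directly by orthogonality of the `Q_S`, flatness `P_i P_i^{(n)} = P_i^{(n)}`,
self-adjointness `integral_conj_mul_cellAvg` and the one-variable cell Parseval).
This is the m-side input of every KLS line (`x ≥ ‖Λ_nΨ‖² = n_n`). -/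
def NumberIdentity : Prop :=
  ∀ (m : ℕ) (L : ℝ), 0 < L → ∀ (Φ : PeriodicTrialState (m + 1) L) (n : Fin 3 → ℤ),
    ∫⁻ X in cellN (m + 1) L, (‖lnssLower L n Φ.ψ X‖₊ : ℝ≥0∞) ^ 2 =
      cellOccupation (m + 1) L (planeWaveMode L n) Φ.ψ

/-- **Core-violation formula** (card (iii)): if a continuous periodic `g` vanishes whenever the pair
`(j, l)` is `close` (a predicate of `x_j, x_l` only — e.g. a periodic image within the hard core), then
ON that set every weighted subset sum `Σ_S w_{|S|} Q_S g` (e.g. `w_s = s^{-1/2}`: the root) reduces to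
first and second DISCRETE DERIVATIVES of the weight against the two-body-local objects `P_j g`, `P_l g`,
`P_j P_l g`, escorted by words over the other particles:
`Σ_S w_{|S|} Q_S g = Σ_{S ⊆ others} (Δw)(|S|)·Q'_S (P_j g + P_l g) + (Δ²w)(|S|)·Q'_S (P_j P_l g)`.
(Decompose `Q_S` by membership of `j, l`; `Q'_S g`, `Q'_S` a word over the others, still vanishes on the
close set; commute the `j, l` factors innermost by `cellAvg_comm`.)  With `|Δ n^{-1/2}| ≤ ½ n^{-3/2}` this
is the source of the `O(ρa³)` L²-smallness of root-induced core violations and of the dressing bookkeeping. -/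
def CoreViolationFormula : Prop :=
  ∀ (m : ℕ) (L : ℝ), 0 < L → ∀ (w : ℕ → ℂ) (g : Config (m + 1) → ℂ), Continuous g →
    (∀ (X : Config (m + 1)) (i : Fin (m + 1)) (a : Fin 3),
        g (X + Pi.single i (EuclideanSpace.single a L)) = g X) →
    ∀ (j l : Fin (m + 1)), j ≠ l → ∀ close : Space → Space → Prop,
    (∀ X : Config (m + 1), close (X j) (X l) → g X = 0) →
    ∀ X : Config (m + 1), close (X j) (X l) →
      (∑ S : Finset (Fin (m + 1)), w S.card * modeProj (m + 1) L S g X) =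
        ∑ S ∈ (Finset.univ : Finset (Finset (Fin (m + 1)))).filter (fun S => j ∉ S ∧ l ∉ S),
          ((w (S.card + 1) - w S.card) *
              (wordOn L ((List.finRange (m + 1)).filter (fun i => decide (i ≠ j ∧ i ≠ l))) S
                  (cellAvg (m + 1) L j g) X +
                wordOn L ((List.finRange (m + 1)).filter (fun i => decide (i ≠ j ∧ i ≠ l))) S
                  (cellAvg (m + 1) L l g) X) +
            (w (S.card + 2) - 2 * w (S.card + 1) + w S.card) *
              wordOn L ((List.finRange (m + 1)).filter (fun i => decide (i ≠ j ∧ i ≠ l))) S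
                (cellAvg (m + 1) L j (cellAvg (m + 1) L l g)) X)

/-- **Window depletion bound** for `v` (the interface KLS → mode counting): for every window parameter
`M` and tolerance `η` there is a density threshold below which, for all large `N` on the torus of side
`(N/ρ)^{1/3}`, the `δ`-near-minimisers have at most `ηN` particles in the non-zero plane waves of the
GD window `0 < 2π‖n‖/L ≤ M √(N/L³)` (sup norm of `n`, exactly `InWindow` of `GaussianDominationCan`).
KLS delivers it from per-mode bounds `n_k ≤ A(C) + B(C,v)ρ/k²` (or `√ρ/k`) summed over the
`O(M³√ρ N)` window modes with the d = 3 counts `#W ≤ (2J+1)³` (`ModeCounting.card_latticeBox`),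
`Σ_{0<‖n‖≤J} ‖n‖⁻¹ ≤ 13J(J+1)` (`ModeCounting.sum_inv_norm_latticeShell_le`), `Σ ‖n‖⁻² ≤ cJ`. -/
def WindowDepletionBound (v : ℝ → ℝ≥0∞) : Prop :=
  ∀ M : ℝ, 0 < M → ∀ η : ℝ, 0 < η → ∃ ρ₀ : ℝ, 0 < ρ₀ ∧ ∀ ρ : ℝ, 0 < ρ → ρ < ρ₀ →
    ∀ᶠ N : ℕ in Filter.atTop, ∃ δ : ℝ≥0∞, 0 < δ ∧
      ∀ Ψ : PeriodicTrialState N (sideLength ρ N),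
        periodicEnergy v Ψ ≤ periodicGroundStateEnergy v N (sideLength ρ N) + δ →
          (∑' p : Fin 3 → ℤ,
              if p ≠ 0 ∧ 2 * Real.pi * ‖(fun j => (p j : ℝ))‖ / sideLength ρ N ≤
                  M * Real.sqrt ((N : ℝ) / sideLength ρ N ^ 3)
              then cellOccupation N (sideLength ρ N) (planeWaveMode (sideLength ρ N) p) Ψ.ψ else 0) ≤
            ENNReal.ofReal (η * N)

/-- The consequent of the crux for ONE potential — verbatim the `PeriodicBEC` body of `GDTransfer`
(`gdTransfer_iff`): condensation in the constant mode for the `δ`-near-minimisers at all small densities. -/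
def PeriodicBECFor (v : ℝ → ℝ≥0∞) : Prop :=
  ∃ ρ₀ : ℝ, 0 < ρ₀ ∧ ∀ ρ : ℝ, 0 < ρ → ρ < ρ₀ → ∃ c : ℝ, 0 < c ∧ ∀ᶠ N : ℕ in Filter.atTop,
    ∃ δ : ENNReal, 0 < δ ∧ ∀ Ψ : PeriodicTrialState N (sideLength ρ N),
      periodicEnergy v Ψ ≤ periodicGroundStateEnergy v N (sideLength ρ N) + δ →
        ENNReal.ofReal (c * N) ≤ condensateOccupation N (sideLength ρ N) Ψ.ψ

/-- The crux, literally, is `GDCan → ∀ v admissible, PeriodicBECFor v` (definitional). -/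
theorem gdTransfer_iff :
    GDTransfer ↔
      (GaussianDominationCan → ∀ v : ℝ → ℝ≥0∞, IsRepulsiveFiniteRange v → PeriodicBECFor v) :=
  Iff.rfl

/-! ## Registered stubs -/

/-- **stub_gammaLinearisation** [size M; plausibly true: verified on paper by all three triagers and
numerically (discrete model) by the planner] — the Γ/Laplace linearisation of `Θ = P₀ n̂₀^{-1/2}`.
Leans on: `Real.Gamma_one_half_eq`, `Real.integral_rpow_mul_exp_neg_mul_Ioi`,
`MeasureTheory.integral_finset_sum`, `Finset.prod_add` (product expansion), `modeProj_succ`,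
`List.foldr` lemmas, `cellAvg_add/sub/const_mul` (linearity on continuous functions). -/
theorem stub_gammaLinearisation : GammaLinearisation := by
  sorry

/-- **stub_numberIdentity** [size M/L; plausibly true: it is `a_n† a_0 n̂₀⁻¹ a_0† a_n = a_n† a_n` on
the Bose-symmetric sector, checked numerically by the planner] — `‖Λ_n Φ‖²_{L²(cell^N)} = ⟨φ_n, γ_Φ φ_n⟩`.
The Γ-representation (hypothesis) turns it into a factor-by-factor product computation plus a Beta
integral; a direct proof by orthogonality of the `Q_S` is equally acceptable.  Leans on:
`cellOccupation_succ`, `nnnorm_sq_integral_conj_planeWaveMode_mul`, `planeWaveMode_eq`,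
`hasSum_sq_cellFourierCoeff`/`tsum_sq_cellFourierCoeff`, `lintegral_cellN_succ`, `integral_conj_mul_cellAvg`,
`cellAvg_cellAvg`, `cellAvg_sub_cellAvg`, `cellAvg_comm`, `PeriodicTrialState.symm`. -/
theorem stub_numberIdentity : GammaLinearisation → NumberIdentity := by
  sorry

/-- **stub_coreViolation** [size M; plausibly true: finite algebra of commuting idempotents plus the
observation that words over the other particles preserve vanishing on the `(j,l)`-close set; the
`N = 2` instance `(n̂₀^{-1/2}Ψ₀)(X*) = h/√2` was computed by ideator 3 and triager 3].  Leans on: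
`cellAvg_comm`, `cellAvg_add`, `cellAvg_sub`, `cellAvg_update`, `continuous_cellAvg`,
`Function.update_comm`, `List.foldr` / `List.filter` lemmas, `Finset.sum_bij`. -/
theorem stub_coreViolation : CoreViolationFormula := by
  sorry

/-- **stub_bareKLS** — the SOFT HALF [size L; plausibly true: this is the filed mechanism of the crux
completed by the card's (ii)]: for integrable admissible `v`, `GaussianDominationCan` implies the window
depletion bound.  Route: unfold GD by `Negative.gaussianDominationCan_iff` (`GDCanWith ρ₀ C N₀ v M`,
`GDIneq`, `InWindow`; real form `Negative.forall_gdIneq_iff` / `real_of_gdIneq`); for a `δ`-near-minimiser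
`Ψ` (finite energy: `Theorems.periodicEnergyFinite_proof`) take the bare witness
`ζ_θ = (e^{iθ} Λ_n + e^{-iθ} Λ_n†) Ψ` (admissible iff `∫ v < ∞`: every term of `n̂₀^{-1/2}` has
interaction energy `≤ ‖v‖₁ L⁻³ ×` flat mass); evaluate the GD chord along `(Ψ + t ζ_θ)/‖·‖`
(`PeriodicTrialState.ofFun`), average over `θ` (kills `ω(Λ†²)`), optimise `s`, let `δ → 0` before
`t → 0` (`ChordLimitKLS`, line `slack-first-phase-averaged-kls`): `x² ≤ 4C'(q_+ + q_-) + η` with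
`x = ‖Λ_nΨ‖² + ‖Λ_n†Ψ‖² ≥ n_n(Ψ)` (hypothesis `NumberIdentity`) and `C' = C L²/‖n‖²`; the second
variations are double commutators up to `O(√δ)`: kinetic `[T, e^{ik·x_i}P_i] = k² e^{ik·x_i}P_i`,
`[T, n̂₀] = 0` give `≤ k²`; interaction: `[v_{jl}, Π_i (1 - cP_i)] = Π_{i∉{j,l}}(1 - cP_i)·[v_{jl}, (1 - cP_j)(1 - cP_l)]`
is TWO-BODY LOCAL, each term `≤ L⁻³‖v‖₁ ×` flat mass, whence `q ≤ k² + c₂ ρ‖v‖₁ (x + 1)` with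
INTENSIVE `c₂` (only the `o_δ(1)` errors may carry `N`), and `n_n ≤ x ≤ 4π√C + 16π²C c₂ρ‖v‖₁/k² + …`;
sum over the window (`#W ≤ (2J+1)³`, `Σ_W ‖n‖⁻² ≤ cJ`, `J = M√ρ L/2π`) to get `≤ ηN` once
`ρ ≤ ρ₀(v, M, η, C(v,M))`.  GD is used at every `t` and at `t = 0`. -/
theorem stub_bareKLS :
    NumberIdentity → GaussianDominationCan →
      ∀ v : ℝ → ℝ≥0∞, IsRepulsiveFiniteRange v → (∫⁻ x : Space, v ‖x‖) ≠ ⊤ →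
        WindowDepletionBound v := by
  sorry

/-- **stub_dressedKLS** — the HARD HALF and the HARDEST stub [size XL; contains the open core of the
crux; plausibly true = the physics of T = 0 KLS with a healed witness, no refutation known (Disproof
notes: "negatives in print: none")]: for NON-integrable admissible `v` (hard cores `v = ⊤` on `[0,a)`,
or finite `v ∉ L¹`) the bare witness has infinite energy and GD's chord is `_ ≤ ⊤`-silent
(`gdChord_of_energy_top` in Disproof.lean), so the witness is DRESSED inside the Γ-product: with `F_i`
the `C¹`-mollified scattering-profile dressing of particle `i` against all others (`pairFactor`/`jastrow`
of `PeriodicBoseGasJastrow`, profile of the GIVEN `v` so that `∫ v F² < ∞`), replace every factor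
`1 - (1 - e^{-t})P_i` of `gammaWord` by `1 - (1 - e^{-t}) F_i P_i F_i` (symmetrised over orderings) and the
kick `Σ_i e^{ik·x_i}P_i` by `Σ_i F_i e^{ik·x_i} P_i F_i`: a two-sided (sandwich) core-safe surrogate
`Λ̃_n†` defined TERM BY TERM, equal to `Λ_n†` at `F = 1` by `GammaLinearisation`.  Then (m-side) the
first-order defect `x̃ - (‖Λ_nΨ‖² + ‖Λ_n†Ψ‖²)` is controlled in WINDOW AGGREGATE
(`Σ_k d_k² ≤ C ρ a³ N` via Parseval in `k`, shell Poincaré `sum_lintegral_shellPair_le` and the exact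
`CoreViolationFormula` for the root-induced violations, `|Δ n^{-1/2}| ≤ ½ n^{-3/2}`), and (energy side)
`q̃(ζ̃) ≤ (c₁ k² + c₂ ρ a)(x̃ + 1)` because every commutator of `T` or `v_{jl}` with a dressed factor is
two- or three-body local (the product form; for a pure hard core `[v, F_jP_jF_j] = 0` identically), with
Dyson–LSSY one-particle elimination (`IsPairProfile.jastrow_sq_erase_le`, `lintegral_cellN_kernel_mul_le`);
near-minimiser plumbing and window sums as in `stub_bareKLS`.  Why it might fail: coherent first-order
defect not summable in the window; three-body terms of `[T_j, F_iP_iF_i]` at the `ρa`-level need the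
unknown near-minimiser's short-range structure (only `T(Ψ) ≤ E₀ + δ` and Dyson are available). -/
theorem stub_dressedKLS :
    GammaLinearisation → NumberIdentity → CoreViolationFormula → GaussianDominationCan →
      ∀ v : ℝ → ℝ≥0∞, IsRepulsiveFiniteRange v → (∫⁻ x : Space, v ‖x‖) = ⊤ →
        WindowDepletionBound v := by
  sorry

/-- **stub_modeCounting** [size M; provable now]: window depletion `≤ ηN` ⇒ condensation.  Template:
`Theorems.ModeCounting.condensate_ge_half` and `IRModeCounting_proof` (file
`Theorems/BECGroundStateSOSIRModeCounting.lean`) with the infrared step `hIR/hIRsum` replaced by the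
aggregate hypothesis.  With `a = (scatteringLength v).toReal < ∞`
(`IsRepulsiveFiniteRange.scatteringLength_ne_top`, `.exists_pos_range`) and Dyson's bound
`E₀^per ≤ 4πρ₁a(1 + C₁ a/b) N ≤ A ρ N` for `ρ` below the LSSY threshold, `N ≥ 2`, `2R₀ < L`
(`LSSY2005_upperBound_periodic_holds`), put `M := 2√(A+1)` (so that on the tail `2π‖p‖/L > M√ρ` one has
`fracDispersion 2 L p ≥ M²ρ = 4(A+1)ρ`), `η := 1/4`, `ρ₀ := min(ρ_W, ρ_LSSY)`, `c := 1/2`,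
`δ := min(δ_W, ofReal(ρN))`: Parseval `Σ_p n_p = N` (`PeriodicTrialState.tsum_cellOccupation_planeWaveMode`)
= condensate (`cellOccupation_planeWaveMode_zero`) + window (`≤ N/4`) + tail
(`≤ (E₀ + δ)/(4(A+1)ρ) ≤ N/4` by `tsum_fracDispersion_two_mul_cellOccupation` and
`ModeCounting.norm_sq_le_sum_sq`); hence `n₀ ≥ N/2`. -/
theorem stub_modeCounting :
    ∀ v : ℝ → ℝ≥0∞, IsRepulsiveFiniteRange v → WindowDepletionBound v → PeriodicBECFor v := by
  sorry

/-! ## Composition: the crux BY NAME from the six stub statements (no `sorry` below this line) -/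

/-- **GDTransfer_of** — the skeleton theorem: the six stub STATEMENTS imply the crux
`BECThomsonPrinciple.GDTransfer` (pure logic: unfold the crux (`gdTransfer_iff`), split on
`∫ v = ∞`, feed the soft/hard KLS stub into mode counting). -/
theorem GDTransfer_of :
    GammaLinearisation →
    (GammaLinearisation → NumberIdentity) →
    CoreViolationFormula →
    (NumberIdentity → GaussianDominationCan →
      ∀ v : ℝ → ℝ≥0∞, IsRepulsiveFiniteRange v → (∫⁻ x : Space, v ‖x‖) ≠ ⊤ →
        WindowDepletionBound v) →
    (GammaLinearisation → NumberIdentity → CoreViolationFormula → GaussianDominationCan →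
      ∀ v : ℝ → ℝ≥0∞, IsRepulsiveFiniteRange v → (∫⁻ x : Space, v ‖x‖) = ⊤ →
        WindowDepletionBound v) →
    (∀ v : ℝ → ℝ≥0∞, IsRepulsiveFiniteRange v → WindowDepletionBound v → PeriodicBECFor v) →
    Summit.AtomisticToContinuum.BoseEinsteinCondensation.Theses.BECThomsonPrinciple.GDTransfer := by
  intro hΓ hN hCore hBare hDress hMC
  refine gdTransfer_iff.mpr ?_
  intro hG v hv
  by_cases hint : (∫⁻ x : Space, v ‖x‖) = ⊤
  · exact hMC v hv (hDress hΓ (hN hΓ) hCore hG v hv hint)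
  · exact hMC v hv (hBare (hN hΓ) hG v hv hint)

/-- The stubs themselves compose to the crux (carries `sorryAx` exactly through the six `stub_*`). -/
theorem GDTransfer_of_stubs :
    Summit.AtomisticToContinuum.BoseEinsteinCondensation.Theses.BECThomsonPrinciple.GDTransfer :=
  GDTransfer_of stub_gammaLinearisation stub_numberIdentity stub_coreViolation stub_bareKLS
    stub_dressedKLS stub_modeCounting

end Summit.AtomisticToContinuum.BoseEinsteinCondensation.Cruxes.GDTransfer.GammaLinearisedRoot

end
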